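import Mathlib
import HarnessLib
import Summits.Ventures.LatticeQCDFlow.Exactness.SpectralCouplingMeasurable
import Summits.Ventures.LatticeQCDFlow.Exactness.SUNResidualLayerEquiv

/-!
# The `SU(N)` spectral coupling layer with invertible box flows is a homeomorphism and a measurable equivalence of configuration space

HONEST FRAMING: exact (Metropolis-corrected) sampling algorithms for lattice gauge theory;
figures of merit are autocorrelation/cost numbers at stated couplings and volumes; no
continuum-physics claim.

Venture `LatticeQCDFlow` (cell pub-lqcd), topic `Exactness`; FANOUT row 10 (`eng-equiv`, engine
`latflow.equiv`, `spectral.SUNSpectralCoupling.forward` / `.inverse` ("the algebraic inverse of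
the box spline, same canonicalisation"), `flow.Flow.inverse`; `flows_jax.scan_flow.flow_inverse`).
NEW WORK of the cell over `SpectralKernelMap.lean` (file 10: kernels invert like their eigenvalue
maps), `SpectralKernelContinuity.lean` (file 16), `SpectralCouplingMeasurable.lean` (file 18:
`continuous_kernelUpdate`) and `SUNResidualLayerEquiv.lean` (file 20: coupling layers with
bijective continuous fibres are homeomorphisms / measurable equivalences); nothing is cited as a
fact; no number; no definition is introduced.  Printed counterpart, NAMED ONLY: Boyda et al.,
PRD 103 (2021) 074504 §III (invertibility of spectral flows) and App. A ("If the function was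
invertible on T, then it is easy to see that it will also be invertible on G").

## What is typed (`n` a finite index type)

* `kernelUpdate_bijective` — any group: `u ↦ h(u S) (u S)⁻¹ u` is bijective as soon as the
  kernel `h` is (it is `u ↦ h(u S) S⁻¹`);
* **`spectralKernel_specialUnitaryGroup_bijective`** / `…_unitaryGroup_bijective` — a kernel
  following the recipe of `f` is a bijection of `SU(n)` (`U(n)`) as soon as some kernel follows
  the recipe of a two-sided inverse `g` of `f` on admissible tuples (Boyda App. A, last sentence);
* **`isHomeomorph_spectralCouplingLayer`** — for frozen-context staples `S a y` (continuous),
  eigenvalue maps `f a y` jointly continuous on context × torus with fibrewise two-sided inverses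
  `g a y` realised by kernels, the spectral coupling layer
  `Theory2.coupleFun p (u_a ↦ h a y (u_a S)(u_a S)⁻¹ u_a)` is a HOMEOMORPHISM of `SU(n)^ι`;
  **`exists_measurableEquiv_spectralCouplingLayer`** — and a measurable equivalence whose forward
  map IS the layer (the object `HasJacobian.map_withDensity_equiv` and the flow-sampler exactness
  files consume, next to `SpectralCouplingLayerExactness.lean`'s Jacobian).

NOT here: the Jacobian (files 18, 23, 25, 27); any number.
-/

noncomputable section

namespace Summit.Ventures.LatticeQCDFlow.Exactness

open MeasureTheory Matrix Topology
open Literature.LinearAlgebra.Matrix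
open Literature.MathematicalPhysics.QuantumFieldTheory

/-! ## Any group: the kernel update inherits bijectivity from the kernel -/

section AnyGroup

variable {G : Type*} [Group G]

/-- **The kernel update `u ↦ h(u S) (u S)⁻¹ u` is bijective when the kernel is**: it is the
composite `u ↦ u S ↦ h(u S) ↦ h(u S) S⁻¹` of bijections (`kernel_update_eq`). -/
theorem kernelUpdate_bijective {h : G → G} (hh : Function.Bijective h) (S : G) :
    Function.Bijective fun u : G => h (u * S) * (u * S)⁻¹ * u := by
  have heq : (fun u : G => h (u * S) * (u * S)⁻¹ * u) = (fun v => v * S⁻¹) ∘ h ∘ fun u => u * S := by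
    funext u
    simp only [Function.comp_apply, kernel_update_eq]
  rw [heq]
  exact (Equiv.mulRight S⁻¹).bijective.comp (hh.comp (Equiv.mulRight S).bijective)

end AnyGroup

/-! ## Kernels of invertible eigenvalue maps are bijections -/

section Kernel

variable {n : Type*} [Fintype n] [DecidableEq n]

/-- **A spectral kernel on `SU(n)` is a bijection** as soon as its eigenvalue map `f` has a
two-sided inverse `g` on admissible tuples (unimodular, product one) that is itself realised by a
kernel `h'` (e.g. `g` permutation equivariant and admissible — `exists_spectralKernel_…`):
`h' ∘ h = id` and `h ∘ h' = id` by `spectralKernel_specialUnitaryGroup_leftInverse`. -/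
theorem spectralKernel_specialUnitaryGroup_bijective {f g : (n → ℂ) → (n → ℂ)}
    {h h' : Matrix.specialUnitaryGroup n ℂ → Matrix.specialUnitaryGroup n ℂ}
    (hf : ∀ (P : Matrix.specialUnitaryGroup n ℂ) (V : Matrix n n ℂ) (d : n → ℂ),
      V ∈ Matrix.unitaryGroup n ℂ → (P : Matrix n n ℂ) = V * diagonal d * star V →
        ((h P : Matrix.specialUnitaryGroup n ℂ) : Matrix n n ℂ) = V * diagonal (f d) * star V)
    (hg : ∀ (P : Matrix.specialUnitaryGroup n ℂ) (V : Matrix n n ℂ) (d : n → ℂ),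
      V ∈ Matrix.unitaryGroup n ℂ → (P : Matrix n n ℂ) = V * diagonal d * star V →
        ((h' P : Matrix.specialUnitaryGroup n ℂ) : Matrix n n ℂ) = V * diagonal (g d) * star V)
    (hgf : ∀ d : n → ℂ, (∀ i, ‖d i‖ = 1) → ∏ i, d i = 1 → g (f d) = d)
    (hfg : ∀ d : n → ℂ, (∀ i, ‖d i‖ = 1) → ∏ i, d i = 1 → f (g d) = d) :
    Function.Bijective h :=
  ⟨(Function.LeftInverse.injective
      (g := h') fun P => spectralKernel_specialUnitaryGroup_leftInverse hf hg hgf P),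
    Function.RightInverse.surjective
      (g := h') fun P => spectralKernel_specialUnitaryGroup_leftInverse hg hf hfg P⟩

/-- **A spectral kernel on `U(n)` is a bijection** under the same hypotheses (inverse on
unimodular tuples). -/
theorem spectralKernel_unitaryGroup_bijective {f g : (n → ℂ) → (n → ℂ)}
    {h h' : Matrix.unitaryGroup n ℂ → Matrix.unitaryGroup n ℂ}
    (hf : ∀ (P : Matrix.unitaryGroup n ℂ) (V : Matrix n n ℂ) (d : n → ℂ),
      V ∈ Matrix.unitaryGroup n ℂ → (P : Matrix n n ℂ) = V * diagonal d * star V →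
        ((h P : Matrix.unitaryGroup n ℂ) : Matrix n n ℂ) = V * diagonal (f d) * star V)
    (hg : ∀ (P : Matrix.unitaryGroup n ℂ) (V : Matrix n n ℂ) (d : n → ℂ),
      V ∈ Matrix.unitaryGroup n ℂ → (P : Matrix n n ℂ) = V * diagonal d * star V →
        ((h' P : Matrix.unitaryGroup n ℂ) : Matrix n n ℂ) = V * diagonal (g d) * star V)
    (hgf : ∀ d : n → ℂ, (∀ i, ‖d i‖ = 1) → g (f d) = d)
    (hfg : ∀ d : n → ℂ, (∀ i, ‖d i‖ = 1) → f (g d) = d) :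
    Function.Bijective h :=
  ⟨(Function.LeftInverse.injective
      (g := h') fun P => spectralKernel_unitaryGroup_leftInverse hf hg hgf P),
    Function.RightInverse.surjective
      (g := h') fun P => spectralKernel_unitaryGroup_leftInverse hg hf hfg P⟩

end Kernel

/-! ## The spectral coupling layer: homeomorphism and measurable equivalence of `SU(n)^ι` -/

section Layer

variable {n : Type*} [Fintype n] [DecidableEq n] {ι : Type*} {p : ι → Prop} [DecidablePred p]

/-- **The `SU(n)` spectral coupling layer with invertible box flows is a HOMEOMORPHISM of
`SU(n)^ι`.**  Data per active link `a` and frozen context `y`: a staple `S a y` (continuous in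
`y`), eigenvalue maps `f a y` (jointly continuous on context × torus) and `g a y`, kernels
`h a y` / `h' a y` following their recipes, `g a y` a two-sided inverse of `f a y` on admissible
tuples.  Then `Theory2.coupleFun p (u_a ↦ h a y (u_a S)(u_a S)⁻¹ u_a)` is a homeomorphism
(bijective continuous fibres on a compact Hausdorff group, `isHomeomorph_coupleFun`). -/
theorem isHomeomorph_spectralCouplingLayer
    (S : {i // p i} → ({i // ¬p i} → Matrix.specialUnitaryGroup n ℂ) → Matrix.specialUnitaryGroup n ℂ)
    (hS : ∀ a, Continuous (S a))
    (f g : {i // p i} → ({i // ¬p i} → Matrix.specialUnitaryGroup n ℂ) → (n → ℂ) → (n → ℂ))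
    (hf : ∀ a, ContinuousOn
      (fun q : ({i // ¬p i} → Matrix.specialUnitaryGroup n ℂ) × (n → ℂ) => f a q.1 q.2)
      {q | ∀ i, ‖q.2 i‖ = 1})
    (h h' : {i // p i} → ({i // ¬p i} → Matrix.specialUnitaryGroup n ℂ) →
      Matrix.specialUnitaryGroup n ℂ → Matrix.specialUnitaryGroup n ℂ)
    (hagree : ∀ a y (P : Matrix.specialUnitaryGroup n ℂ) (V : Matrix n n ℂ) (d : n → ℂ),
      V ∈ Matrix.unitaryGroup n ℂ → (P : Matrix n n ℂ) = V * diagonal d * star V →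
        ((h a y P : Matrix.specialUnitaryGroup n ℂ) : Matrix n n ℂ) = V * diagonal (f a y d) * star V)
    (hagree' : ∀ a y (P : Matrix.specialUnitaryGroup n ℂ) (V : Matrix n n ℂ) (d : n → ℂ),
      V ∈ Matrix.unitaryGroup n ℂ → (P : Matrix n n ℂ) = V * diagonal d * star V →
        ((h' a y P : Matrix.specialUnitaryGroup n ℂ) : Matrix n n ℂ) = V * diagonal (g a y d) * star V)
    (hgf : ∀ a y (d : n → ℂ), (∀ i, ‖d i‖ = 1) → ∏ i, d i = 1 → g a y (f a y d) = d)
    (hfg : ∀ a y (d : n → ℂ), (∀ i, ‖d i‖ = 1) → ∏ i, d i = 1 → f a y (g a y d) = d) :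
    IsHomeomorph (Theory2.coupleFun p fun a y (u : Matrix.specialUnitaryGroup n ℂ) =>
      h a y (u * S a y) * (u * S a y)⁻¹ * u) :=
  isHomeomorph_coupleFun
    (fun a y => kernelUpdate_bijective
      (spectralKernel_specialUnitaryGroup_bijective (hagree a y) (hagree' a y) (hgf a y) (hfg a y)) (S a y))
    fun a => continuous_kernelUpdate (continuous_spectralKernel_specialUnitaryGroup_param (hf a) (hagree a))
      (hS a)

/-- **… and a measurable equivalence of `SU(n)^ι` whose forward map IS the layer** (countable
link set): the spectral coupling layer is a measurable bijection with measurable inverse. -/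
theorem exists_measurableEquiv_spectralCouplingLayer [Countable ι]
    (S : {i // p i} → ({i // ¬p i} → Matrix.specialUnitaryGroup n ℂ) → Matrix.specialUnitaryGroup n ℂ)
    (hS : ∀ a, Continuous (S a))
    (f g : {i // p i} → ({i // ¬p i} → Matrix.specialUnitaryGroup n ℂ) → (n → ℂ) → (n → ℂ))
    (hf : ∀ a, ContinuousOn
      (fun q : ({i // ¬p i} → Matrix.specialUnitaryGroup n ℂ) × (n → ℂ) => f a q.1 q.2)
      {q | ∀ i, ‖q.2 i‖ = 1})
    (h h' : {i // p i} → ({i // ¬p i} → Matrix.specialUnitaryGroup n ℂ) →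
      Matrix.specialUnitaryGroup n ℂ → Matrix.specialUnitaryGroup n ℂ)
    (hagree : ∀ a y (P : Matrix.specialUnitaryGroup n ℂ) (V : Matrix n n ℂ) (d : n → ℂ),
      V ∈ Matrix.unitaryGroup n ℂ → (P : Matrix n n ℂ) = V * diagonal d * star V →
        ((h a y P : Matrix.specialUnitaryGroup n ℂ) : Matrix n n ℂ) = V * diagonal (f a y d) * star V)
    (hagree' : ∀ a y (P : Matrix.specialUnitaryGroup n ℂ) (V : Matrix n n ℂ) (d : n → ℂ),
      V ∈ Matrix.unitaryGroup n ℂ → (P : Matrix n n ℂ) = V * diagonal d * star V →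
        ((h' a y P : Matrix.specialUnitaryGroup n ℂ) : Matrix n n ℂ) = V * diagonal (g a y d) * star V)
    (hgf : ∀ a y (d : n → ℂ), (∀ i, ‖d i‖ = 1) → ∏ i, d i = 1 → g a y (f a y d) = d)
    (hfg : ∀ a y (d : n → ℂ), (∀ i, ‖d i‖ = 1) → ∏ i, d i = 1 → f a y (g a y d) = d) :
    ∃ e : (ι → Matrix.specialUnitaryGroup n ℂ) ≃ᵐ (ι → Matrix.specialUnitaryGroup n ℂ),
      ⇑e = Theory2.coupleFun p fun a y (u : Matrix.specialUnitaryGroup n ℂ) =>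
        h a y (u * S a y) * (u * S a y)⁻¹ * u :=
  exists_measurableEquiv_coupleFun
    (fun a y => kernelUpdate_bijective
      (spectralKernel_specialUnitaryGroup_bijective (hagree a y) (hagree' a y) (hgf a y) (hfg a y)) (S a y))
    fun a => continuous_kernelUpdate (continuous_spectralKernel_specialUnitaryGroup_param (hf a) (hagree a))
      (hS a)

end Layer

end Summit.Ventures.LatticeQCDFlow.Exactness
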